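import Summits.SmoothPoincare4.SmoothPoincare4.Theorems.SullivanDualTargetKaehlerJacketDefs
import Summits.SmoothPoincare4.SmoothPoincare4.Theorems.SullivanDualTargetStubBallExtension
import Summits.SmoothPoincare4.SmoothPoincare4.Theorems.SullivanDualTargetStubStandardEnd
import Summits.SmoothPoincare4.SmoothPoincare4.Theorems.SullivanDualTargetStubLiouvilleCollar
import Summits.SmoothPoincare4.SmoothPoincare4.Theorems.SullivanDualTargetHelperStarJacketOfChartForm
import Summits.SmoothPoincare4.SmoothPoincare4.Theorems.SullivanDualTargetIffSummit
import Literature.Geometry.Symplectic.GromovR4StdModel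

/-!
# SmoothPoincare4 / SullivanDual — crux `Target` (stmt-SmoothPoincare4-7823), line `kaehler-jacket`:
# CERTIFICATE — the folded apex `StarJacketAt` is equivalent, puncture by puncture and modulo the
# route's named fact `GromovChartForm`, to a symplectic form standard near the puncture, i.e. to
# the matrix of `Target` (lead c6)

* `exists_isSymplecticStandardNearPoint_of_starJacketAt` — **apex ⇒ symplectic-standard-near-`p`**
  (unconditional): the landed `stub_ballExtension` (p133004) caps the inner puncture by the
  star-shaped ball and `stub_standardEnd` (p132182) reads the end at `p`; this is the glue of the
  skeleton `Cruxes/Target/Lines/kaehler_jacket.lean` minus the door.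
* `starJacketAt_of_nonempty_diffeomorph_sphere` — **`Σ ≅ S⁴` ⇒ apex** (unconditional): Palais'
  disc theorem in chart form (`palais_puncturedSphere_chartForm_holds`, PROVED in tree) gives a
  chart-form diffeomorphism `Σ ∖ p ≃ ℝ⁴`, and the landed `helper_starJacketOfChartForm`
  linearises it at the inner puncture (QR normalisation + log-slow interpolations).
* `starJacketAt_iff_exists_isSymplecticStandardNearPoint` — **apex ⟺ SympcapThesis-at-`(Σ,p)`**
  given `GromovChartForm` (the route's single genuinely needed named fact, which turns a
  symplectic form standard near `p` into `Σ ≅ S⁴`); whence `StarJacketAt S p ↔ StarJacketAt S p'`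
  (one puncture decides), `(∀ Σ p, StarJacketAt Σ p) ↔ Target ↔ SmoothPoincare4`.

So the one open stub of line `kaehler-jacket` is kernel-certified to be the crux in different
clothing (as every apex of an SPC4-equivalent crux must be); what the line adds to the tree is
the unconditional capping/normalisation mathematics around it.

References: H. Geiges, *An Introduction to Contact Topology* (2008), Lemma 5.2.4 [Geiges2008];
R. S. Palais, *Extending diffeomorphisms*, Proc. AMS 11 (1960), Thm. B [Palais1960]; M. Gromov,
Invent. Math. 82 (1985), §0.3.C [Gromov1985].
-/

noncomputable section

set_option linter.dupNamespace false

open scoped Manifold ContDiff Topology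
open Set Function
open Literature.Geometry.Kaehler (MForm IsSmoothForm IsClosedForm mextDeriv)
open Literature.Geometry.Symplectic (punctured InPuncturedChartBall stdSymplecticForm inversion
  invertedStdForm IsSymplecticStandardNearPoint AgreesWithInvertedChartNear
  palais_puncturedSphere_chartForm_holds)
open Literature.Topology.FourManifolds (HomotopySphere)
open Summit.SmoothPoincare4.SmoothPoincare4.Theses.SullivanDual (Target GromovChartForm)

namespace Summit.SmoothPoincare4.SmoothPoincare4.Theorems.Target.KaehlerJacket

local notation "E4" => EuclideanSpace ℝ (Fin 4)
local notation "𝕊⁴" => Metric.sphere (0 : EuclideanSpace ℝ (Fin 5)) 1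

/-- **Apex ⇒ a symplectic form standard near `p`** (unconditional): cap the inner puncture by the
star-shaped ball (`stub_ballExtension`) and read the end at `p` (`stub_standardEnd`).
[cite: Geiges2008, Lemma 5.2.4] -/
theorem exists_isSymplecticStandardNearPoint_of_starJacketAt (S : HomotopySphere 4)
    (p : S.carrier) (h : StarJacketAt S p) :
    ∃ (ε : ℝ) (sf : MForm (𝓡 4) (punctured p) ℝ 2), IsSymplecticStandardNearPoint p ε sf := by
  obtain ⟨q, hq, F, μ, μ', A, u, Ψ, δ₁, hF, hFp, hμ, hμμ', hball, havoid, hu, hδ₁,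
    hΨemb, hΨinj, hΨsymp, hΨsphere, hΨsides⟩ := h
  obtain ⟨sf, hs, hc, hnd, hoff⟩ :=
    stub_ballExtension S p q F μ μ' A u Ψ δ₁ hq hF hμ hμμ' hball havoid hu hδ₁
      hΨemb hΨinj hΨsymp hΨsphere hΨsides
  obtain ⟨ε, hε⟩ :=
    stub_standardEnd S p q F μ sf hFp
      ((Metric.closedBall_subset_closedBall hμμ'.le).trans hball)
      (fun y hy => havoid y (Metric.closedBall_subset_closedBall hμμ'.le hy)) hs hc hnd hoff
  exact ⟨ε, sf, hε⟩

/-- **A chart-form diffeomorphism gives the apex** (`helper_starJacketOfChartForm`, repackaged).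
[folklore] -/
theorem starJacketAt_of_chartForm (S : HomotopySphere 4) (p : S.carrier)
    (Φ : (punctured p) ≃ₘ⟮𝓡 4, 𝓡 4⟯ E4) (hΦ : AgreesWithInvertedChartNear p Φ) :
    StarJacketAt S p :=
  helper_starJacketOfChartForm S p Φ hΦ

/-- **`Σ ≅ S⁴` ⇒ apex at every puncture** (unconditional; Palais' disc theorem in chart form,
PROVED in tree as `palais_puncturedSphere_chartForm_holds`). [cite: Palais1960, Thm. B] -/
theorem starJacketAt_of_nonempty_diffeomorph_sphere (S : HomotopySphere 4)
    (hS : Nonempty (S.carrier ≃ₘ⟮𝓡 4, 𝓡 4⟯ 𝕊⁴)) (p : S.carrier) : StarJacketAt S p := by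
  obtain ⟨Φ, hΦ⟩ := palais_puncturedSphere_chartForm_holds S.carrier p hS
  exact starJacketAt_of_chartForm S p Φ hΦ

/-- **Symplectic-standard-near-`p` ⇒ apex**, given the route's named fact `GromovChartForm`
(which makes `Σ ≅ S⁴`). [cite: Gromov1985, §0.3.C] -/
theorem starJacketAt_of_isSymplecticStandardNearPoint (hG : GromovChartForm) (S : HomotopySphere 4)
    (p : S.carrier) {ε : ℝ} {sf : MForm (𝓡 4) (punctured p) ℝ 2}
    (hsf : IsSymplecticStandardNearPoint p ε sf) : StarJacketAt S p :=
  starJacketAt_of_nonempty_diffeomorph_sphere S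
    (Summit.SmoothPoincare4.SmoothPoincare4.Theorems.gromovChartForm_iff_forall_nonempty_diffeomorph_sphere.1
      hG S p ε sf hsf) p

/-- **CERTIFICATE (pointwise): apex ⟺ a symplectic form standard near `p`**, given
`GromovChartForm`. [cite: Gromov1985, §0.3.C] -/
theorem starJacketAt_iff_exists_isSymplecticStandardNearPoint (hG : GromovChartForm)
    (S : HomotopySphere 4) (p : S.carrier) :
    StarJacketAt S p ↔
      ∃ (ε : ℝ) (sf : MForm (𝓡 4) (punctured p) ℝ 2), IsSymplecticStandardNearPoint p ε sf :=
  ⟨exists_isSymplecticStandardNearPoint_of_starJacketAt S p,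
    fun ⟨_, _, hsf⟩ => starJacketAt_of_isSymplecticStandardNearPoint hG S p hsf⟩

/-- **Apex ⟺ `Σ ≅ S⁴`**, given `GromovChartForm`. [cite: Gromov1985, §0.3.C] -/
theorem starJacketAt_iff_nonempty_diffeomorph_sphere (hG : GromovChartForm) (S : HomotopySphere 4)
    (p : S.carrier) : StarJacketAt S p ↔ Nonempty (S.carrier ≃ₘ⟮𝓡 4, 𝓡 4⟯ 𝕊⁴) :=
  ⟨fun h => by
      obtain ⟨ε, sf, hsf⟩ := exists_isSymplecticStandardNearPoint_of_starJacketAt S p h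
      exact Summit.SmoothPoincare4.SmoothPoincare4.Theorems.gromovChartForm_iff_forall_nonempty_diffeomorph_sphere.1
        hG S p ε sf hsf,
    fun hS => starJacketAt_of_nonempty_diffeomorph_sphere S hS p⟩

/-- **One puncture decides**: given `GromovChartForm`, the apex at one puncture of `Σ` gives it
at every puncture. [folklore] -/
theorem starJacketAt_of_starJacketAt (hG : GromovChartForm) (S : HomotopySphere 4)
    (p p' : S.carrier) (h : StarJacketAt S p) : StarJacketAt S p' :=
  starJacketAt_of_nonempty_diffeomorph_sphere S
    ((starJacketAt_iff_nonempty_diffeomorph_sphere hG S p).1 h) p'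

/-- **Apex everywhere ⇒ `Target`** (unconditional): through the door
`SullivanDual.target_of_sympcapThesisV2` (p119400) — this is the skeleton's `Target_of`.
[cite: Gromov1985, §0.3.C] -/
theorem target_of_forall_starJacketAt (h : ∀ (S : HomotopySphere 4) (p : S.carrier), StarJacketAt S p) :
    Target :=
  Summit.SmoothPoincare4.SmoothPoincare4.Theorems.SullivanDual.target_of_sympcapThesisV2
    fun S p => exists_isSymplecticStandardNearPoint_of_starJacketAt S p (h S p)

/-- **`SmoothPoincare4` ⇒ apex everywhere** (unconditional). [cite: Palais1960, Thm. B] -/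
theorem forall_starJacketAt_of_smoothPoincare4 (h : _root_.SmoothPoincare4)
    (S : HomotopySphere 4) (p : S.carrier) : StarJacketAt S p :=
  starJacketAt_of_nonempty_diffeomorph_sphere S
    (Summit.SmoothPoincare4.SmoothPoincare4.Theorems.SullivanDual.nonempty_diffeomorph_sphere_of_smoothPoincare4 h S) p

/-- **CERTIFICATE (global): apex everywhere ⟺ `Target`**, given `GromovChartForm`
(`→` unconditional; `←` via `Target ∧ GromovChartForm → SmoothPoincare4`, p120412).
[cite: Gromov1985, §0.3.C] -/
theorem forall_starJacketAt_iff_target (hG : GromovChartForm) :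
    (∀ (S : HomotopySphere 4) (p : S.carrier), StarJacketAt S p) ↔ Target :=
  ⟨target_of_forall_starJacketAt, fun hT =>
    forall_starJacketAt_of_smoothPoincare4
      (Summit.SmoothPoincare4.SmoothPoincare4.Theorems.SullivanDual.smoothPoincare4_of_target hG hT)⟩

/-- **Apex everywhere ⟺ `SmoothPoincare4`**, given `GromovChartForm`. [cite: Gromov1985, §0.3.C] -/
theorem forall_starJacketAt_iff_smoothPoincare4 (hG : GromovChartForm) :
    (∀ (S : HomotopySphere 4) (p : S.carrier), StarJacketAt S p) ↔ _root_.SmoothPoincare4 :=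
  ⟨fun h => Summit.SmoothPoincare4.SmoothPoincare4.Theorems.SullivanDual.smoothPoincare4_of_target hG
      (target_of_forall_starJacketAt h),
    forall_starJacketAt_of_smoothPoincare4⟩

/-- **Registered statement `helper_starJacketCertificate`**: given `GromovChartForm`, the folded
apex of line `kaehler-jacket` holds at every puncture of every homotopy 4-sphere iff `Target`.
[cite: Gromov1985, §0.3.C] -/
theorem helper_starJacketCertificate :
    GromovChartForm → ((∀ (S : HomotopySphere 4) (p : S.carrier), StarJacketAt S p) ↔ Target) :=
  forall_starJacketAt_iff_target

/-! ## Addendum (after the landing of `stub_liouvilleCollar`, p135853): the v1 apex gives the fold -/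

/-- **The v1 apex gives the folded apex** (registered `helper_starJacketAt_of_tightInnerSphereAt`):
the data of `stub_tightInnerSphere` at `(Σ, p)` (jacket with a contact-type inner chart-sphere,
Liouville field outward, tight characteristic structure in T-ext form) yield `StarJacketAt S p`
through the LANDED Liouville collar `stub_liouvilleCollar` (Geiges 2008, Lemma 5.2.4) — so the
fold of the skeleton's apex loses nothing. [cite: Geiges2008, Lemma 5.2.4] -/
theorem helper_starJacketAt_of_tightInnerSphereAt :
    ∀ (S : HomotopySphere 4) (p : S.carrier),
      (∃ q : S.carrier, q ≠ p ∧
      ∃ (F : punctured p → E4) (μ μ' δ : ℝ) (α : MForm (𝓡 4) (punctured p) ℝ 1)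
        (Z : ∀ x : punctured p, TangentSpace (𝓡 4) x) (A : E4 ≃ₗᵢ[ℝ] E4) (u : E4 → ℝ),
        (∀ x : punctured p, x.1 ≠ q →
          ContMDiffAt (𝓡 4) 𝓘(ℝ, E4) ∞ F x ∧ Injective (mfderiv (𝓡 4) 𝓘(ℝ, E4) F x)) ∧
        AgreesWithInvertedChartNear p F ∧
        0 < μ ∧ μ < μ' ∧ 0 < δ ∧
        Metric.closedBall (extChartAt (𝓡 4) q q) μ' ⊆ (extChartAt (𝓡 4) q).target ∧
        (∀ y ∈ Metric.closedBall (extChartAt (𝓡 4) q q) μ', (extChartAt (𝓡 4) q).symm y ≠ p) ∧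
        IsSmoothForm α ∧ ContDiff ℝ ∞ u ∧
        (∀ x : punctured p, x.1 ∈ (chartAt E4 q).source →
          |‖extChartAt (𝓡 4) q x.1 - extChartAt (𝓡 4) q q‖ - μ| < δ →
          ∀ v w : TangentSpace (𝓡 4) x, mextDeriv α x ![v, w] =
            stdSymplecticForm (mfderiv (𝓡 4) 𝓘(ℝ, E4) F x v) (mfderiv (𝓡 4) 𝓘(ℝ, E4) F x w)) ∧
        (∀ x : punctured p, x.1 ∈ (chartAt E4 q).source →
          |‖extChartAt (𝓡 4) q x.1 - extChartAt (𝓡 4) q q‖ - μ| < δ →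
          ∀ w : TangentSpace (𝓡 4) x,
            stdSymplecticForm (mfderiv (𝓡 4) 𝓘(ℝ, E4) F x (Z x)) (mfderiv (𝓡 4) 𝓘(ℝ, E4) F x w) =
              α x ![w]) ∧
        (∀ x : punctured p, x.1 ∈ (chartAt E4 q).source →
          ‖extChartAt (𝓡 4) q x.1 - extChartAt (𝓡 4) q q‖ = μ →
          0 < @inner ℝ E4 _ (mfderiv (𝓡 4) 𝓘(ℝ, E4) (fun z : punctured p => extChartAt (𝓡 4) q z.1) x (Z x))
            (extChartAt (𝓡 4) q x.1 - extChartAt (𝓡 4) q q)) ∧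
        (∀ x : punctured p, x.1 ∈ (chartAt E4 q).source →
          ‖extChartAt (𝓡 4) q x.1 - extChartAt (𝓡 4) q q‖ = μ →
          ∀ v : TangentSpace (𝓡 4) x,
            @inner ℝ E4 _ (mfderiv (𝓡 4) 𝓘(ℝ, E4) (fun z : punctured p => extChartAt (𝓡 4) q z.1) x v)
              (extChartAt (𝓡 4) q x.1 - extChartAt (𝓡 4) q q) = 0 →
            α x ![v] =
              Real.exp (u (A.symm (μ⁻¹ • (extChartAt (𝓡 4) q x.1 - extChartAt (𝓡 4) q q)))) *
                (1 / 2 * stdSymplecticForm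
                  (A.symm (μ⁻¹ • (extChartAt (𝓡 4) q x.1 - extChartAt (𝓡 4) q q)))
                  (A.symm (μ⁻¹ • (mfderiv (𝓡 4) 𝓘(ℝ, E4)
                    (fun z : punctured p => extChartAt (𝓡 4) q z.1) x v : E4)))))) →
      StarJacketAt S p := by
  intro S p h
  obtain ⟨q, hq, F, μ, μ', δ, α, Z, A, u, hF, hFp, hμ, hμμ', hδ, hball, havoid, hα, hu,
    hprim, hdual, hout, htext⟩ := h
  obtain ⟨Ψ, δ₁, hδ₁, hΨemb, hΨinj, hΨsymp, hΨsphere, hΨsides⟩ :=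
    stub_liouvilleCollar S p q F μ μ' δ α Z A u hq hF hμ hμμ' hδ hball havoid hα hu
      hprim hdual hout htext
  exact ⟨q, hq, F, μ, μ', A, u, Ψ, δ₁, hF, hFp, hμ, hμμ', hball, havoid, hu, hδ₁,
    hΨemb, hΨinj, hΨsymp, hΨsphere, hΨsides⟩

end Summit.SmoothPoincare4.SmoothPoincare4.Theorems.Target.KaehlerJacket

end
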